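import Literature.NumberTheory.EllipticCurves.Rank1Residual.CyclotomicWindingSpan
import Literature.NumberTheory.EllipticCurves.PAdicLFunctionDistributionHoldsProofs
import Literature.NumberTheory.EllipticCurves.PAdicLFunctionIntegralityProofs
import Literature.NumberTheory.EllipticCurves.ModularSymbolsEichlerShimuraHoldsProofs
import HarnessLib

/-!
# Route `PrintX8`, crux 20622 `MuBoundSmallImageX8` — LINE «vertical Stevens at 3»:
# the period functional `γ ↦ re{∞, γ∞}_f` on `Γ₀(N)` and the Hecke-term elements (bridge, part 1)

Cell `bsd-print-x8`, seat p1 (gen 4), `--supports stmt-BirchSwinnertonDyer-20622`.  Theorems only; every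
analytic input is a tree THEOREM (`cuspSymbol_mul_holds`, `modularSymbol_gamma0_smul_holds` — Manin 1972
Prop. 1.4 / Thm. 1.6; `plusSymbol_eq_re_holds`; the period convention `re Λ_f = ℤ·Ω⁺_f/2`).  Part 2
(`PrintX8VerticalStevensBridge.lean`) assembles these into the bridge «mod-`p` span of the `p`-power
winding classes + `a_p ≢ 1 (mod p)` ⟹ `[·]⁺_f` non-constant mod `p` on `ℤ[1/p]`».

## Contents
* `cuspSymbol_pow`, `cuspSymbol_eq_zero_of_isOfFinOrder`, `cuspSymbol_eq_zero_of_trEntry`: the period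
  `{∞, γ∞}_f` is additive in `γ`, vanishes on finite-order elements, and vanishes on trace-`±2` elements
  (at the fixed cusp `s = (a−d)/2c`, `{∞, γ∞} = {∞, γs} − {∞, s} = 0` by Manin's relation; `c = 0`:
  by definition).
* `ratCast_ratPlusSymbol_moebius_sub` (`[γr]⁺ − [r]⁺ = re{∞,γ∞}/Ω⁺`), `ratCast_ratPlusSymbol_apply_infty`
  (`[a/c]⁺ = re{∞,γ∞}/Ω⁺`, `c ≠ 0`), `exists_re_cuspSymbol_eq` (`re{∞,γ∞} ∈ ℤ·Ω⁺/2`),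
  `not_forall_dvd_of_realPeriods` (primitivity: the `re{∞,γ∞}` cannot all lie in `ℤ·pΩ⁺/2`).
* `exists_gamma0_of_isCoprime` (Bezout element `(u ∗; w x) ∈ Γ₀(N)`), `dEntry_mul_inv`,
  `inGammaH_mul_inv_of_eq_pow`, `pow_totient_sub_one_mul_self` (`p⁻¹ = p^{φ(N)−1}` in `ℤ/N`),
  `exists_heckeTerm_mem`, `exists_heckeTerm_mem'`: each term `(a+jc)/(pc)`, `pa/c` of the Hecke
  relation at `x = a/c = γ∞` is `δ∞` for some `δ ∈ Γ₀(N)` with `δγ⁻¹ ∈ Γ_H(N)` (`d(δγ⁻¹) ≡ 1, p, p⁻¹`).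
-/

-- the summit namespace repeats `BirchSwinnertonDyer` by design (summit = problem); linter moot
set_option linter.dupNamespace false
set_option autoImplicit false

noncomputable section

namespace Summit.BirchSwinnertonDyer.BirchSwinnertonDyer.Theorems.PrintX8VerticalStevens

open scoped MatrixGroups ModularForm

open CongruenceSubgroup Matrix Matrix.SpecialLinearGroup
  Literature.NumberTheory.EllipticCurves Literature.NumberTheory.EllipticCurves.ModularForms
  Literature.NumberTheory.EllipticCurves.Rank1Residual

section Periods

variable {N : ℕ} [NeZero N] (f : CuspForm (Gamma0 N) 2)

/-- `{∞, γⁿ∞}_f = n · {∞, γ∞}_f` (Manin: `γ ↦ {∞, γ∞}` is a homomorphism, `cuspSymbol_mul_holds`). -/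
theorem cuspSymbol_pow (γ : Gamma0 N) (n : ℕ) : cuspSymbol f (γ ^ n) = n * cuspSymbol f γ := by
  induction n with
  | zero => simp
  | succ n ih => rw [pow_succ, cuspSymbol_mul_holds f, ih]; push_cast; ring

/-- Elements of finite order have period `0`: `n·{∞, γ∞} = {∞, γⁿ∞} = {∞, ∞} = 0`. -/
theorem cuspSymbol_eq_zero_of_isOfFinOrder {γ : Gamma0 N} (h : IsOfFinOrder γ) :
    cuspSymbol f γ = 0 := by
  obtain ⟨n, hn, hγn⟩ := h.exists_pow_eq_one
  have h1 := cuspSymbol_pow f γ n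
  rw [hγn, cuspSymbol_one] at h1
  have hn' : (n : ℂ) ≠ 0 := Nat.cast_ne_zero.mpr hn.ne'
  exact (mul_eq_zero.mp h1.symm).resolve_left hn'

/-- Elements of trace `±2` (parabolic elements and `±I`) have period `0`: if `c = 0` by definition of
`cuspSymbol`; if `c ≠ 0` the cusp `s = (a − d)/(2c)` is fixed by `γ` (`tr² = 4 det`), `cs + d = ±1 ≠ 0`,
and Manin's relation `{∞, γs} = {∞, γ∞} + {∞, s}` (`modularSymbol_gamma0_smul_holds`) gives
`{∞, γ∞} = 0`. -/
theorem cuspSymbol_eq_zero_of_trEntry {γ : Gamma0 N} (h : trEntry γ = 2 ∨ trEntry γ = -2) :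
    cuspSymbol f γ = 0 := by
  set a : ℤ := (γ : SL(2, ℤ)) 0 0 with ha
  set b : ℤ := (γ : SL(2, ℤ)) 0 1 with hb
  set c : ℤ := (γ : SL(2, ℤ)) 1 0 with hc
  set d : ℤ := (γ : SL(2, ℤ)) 1 1 with hd
  have hdet : a * d - b * c = 1 := by
    have := Matrix.SpecialLinearGroup.det_coe (γ : SL(2, ℤ))
    rw [Matrix.det_fin_two] at this
    rw [ha, hb, hc, hd]; linear_combination this
  have htr : a + d = 2 ∨ a + d = -2 := by simpa [trEntry, ha, hd] using h
  by_cases hc0 : c = 0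
  · simp [cuspSymbol, ← hc, hc0]
  · -- the fixed cusp
    set s : ℚ := ((a : ℚ) - d) / (2 * c) with hs
    have hc' : (c : ℚ) ≠ 0 := by exact_mod_cast hc0
    have hdetQ : (a : ℚ) * d - b * c = 1 := by exact_mod_cast hdet
    -- `(a - d)² + 4bc = (a + d)² - 4 = 0`
    have h4 : ((a : ℚ) - d) ^ 2 + 4 * b * c = 0 := by
      rcases htr with htr | htr
      · have htrQ : (a : ℚ) + d = 2 := by exact_mod_cast htr
        linear_combination ((a : ℚ) + d + 2) * htrQ - 4 * hdetQ
      · have htrQ : (a : ℚ) + d = -2 := by exact_mod_cast htr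
        linear_combination ((a : ℚ) + d - 2) * htrQ - 4 * hdetQ
    have h2cs : 2 * (c : ℚ) * s = a - d := by rw [hs]; field_simp
    have hcs : (c : ℚ) * s ^ 2 + b = 0 := by
      have h0 : 4 * (c : ℚ) * (c * s ^ 2 + b) = 0 := by
        linear_combination (2 * (c : ℚ) * s + (a - d)) * h2cs + h4
      have h4c : 4 * (c : ℚ) ≠ 0 := mul_ne_zero (by norm_num) hc'
      exact (mul_eq_zero.mp h0).resolve_left h4c
    have hden : (c : ℚ) * s + d ≠ 0 := by
      have h2 : 2 * ((c : ℚ) * s + d) = a + d := by linear_combination h2cs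
      intro h0
      rw [h0, mul_zero] at h2
      rcases htr with htr | htr
      · have htrQ : (a : ℚ) + d = 2 := by exact_mod_cast htr
        linarith
      · have htrQ : (a : ℚ) + d = -2 := by exact_mod_cast htr
        linarith
    have hfix : ((a : ℚ) * s + b) / ((c : ℚ) * s + d) = s := by
      rw [div_eq_iff hden]
      linear_combination hcs - s * h2cs
    have key := modularSymbol_gamma0_smul_holds f γ s (by simpa [← hc, ← hd] using hden)
    simp only [← ha, ← hb, ← hc, ← hd] at key
    rw [hfix] at key
    linear_combination -key

/-- **Manin's relation for the rational plus symbols**: `[γr]⁺_f − [r]⁺_f = re{∞, γ∞}_f / Ω⁺_f` for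
`γ ∈ Γ₀(N)` and `cr + d ≠ 0` (real coefficients, rational symbols: `plusSymbol_eq_re_holds`,
`modularSymbol_gamma0_smul_holds`). -/
theorem ratCast_ratPlusSymbol_moebius_sub
    (hrat : ∀ r : ℚ, (ratPlusSymbol f r : ℝ) = normalizedPlusSymbol f r)
    (hreal : ∀ n, (cuspCoeff f n).im = 0) (γ : Gamma0 N) (r : ℚ)
    (hr : ((γ : SL(2, ℤ)) 1 0 : ℚ) * r + ((γ : SL(2, ℤ)) 1 1 : ℚ) ≠ 0) :
    (ratPlusSymbol f
        ((((γ : SL(2, ℤ)) 0 0 : ℚ) * r + ((γ : SL(2, ℤ)) 0 1 : ℚ)) /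
          (((γ : SL(2, ℤ)) 1 0 : ℚ) * r + ((γ : SL(2, ℤ)) 1 1 : ℚ))) : ℝ) -
      ratPlusSymbol f r = (cuspSymbol f γ).re / plusPeriod f := by
  rw [hrat, hrat, normalizedPlusSymbol, normalizedPlusSymbol, plusSymbol_eq_re_holds f hreal,
    plusSymbol_eq_re_holds f hreal, Complex.ofReal_re, Complex.ofReal_re,
    modularSymbol_gamma0_smul_holds f γ r hr, Complex.add_re]
  ring

/-- **The period as a plus symbol at `γ∞`**: `[a/c]⁺_f = re{∞, γ∞}_f / Ω⁺_f` for `γ = (a b; c d)`,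
`c ≠ 0` (definition of `cuspSymbol`, `plusSymbol_eq_re_holds`). -/
theorem ratCast_ratPlusSymbol_apply_infty
    (hrat : ∀ r : ℚ, (ratPlusSymbol f r : ℝ) = normalizedPlusSymbol f r)
    (hreal : ∀ n, (cuspCoeff f n).im = 0) (γ : Gamma0 N) (hc : ((γ : SL(2, ℤ)) 1 0 : ℤ) ≠ 0) :
    (ratPlusSymbol f (((γ : SL(2, ℤ)) 0 0 : ℚ) / ((γ : SL(2, ℤ)) 1 0 : ℚ)) : ℝ) =
      (cuspSymbol f γ).re / plusPeriod f := by
  rw [hrat, normalizedPlusSymbol, plusSymbol_eq_re_holds f hreal, Complex.ofReal_re, cuspSymbol,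
    if_neg hc]

omit [NeZero N] in
/-- Every period has real part in `ℤ·Ω⁺_f/2` (the period convention `re Λ_f = ℤ·Ω⁺_f/2`). -/
theorem exists_re_cuspSymbol_eq (hre : realPeriods f = AddSubgroup.zmultiples (plusPeriod f / 2))
    (γ : Gamma0 N) : ∃ m : ℤ, (cuspSymbol f γ).re = m * (plusPeriod f / 2) := by
  have h : (cuspSymbol f γ).re ∈ realPeriods f :=
    AddSubgroup.mem_map_of_mem _ (cuspSymbol_mem_periodLattice f γ)
  rw [hre, AddSubgroup.mem_zmultiples_iff] at h
  obtain ⟨m, hm⟩ := h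
  exact ⟨m, by rw [← hm, zsmul_eq_mul]⟩

omit [NeZero N] in
/-- **Primitivity of the period functional**: the real parts of the periods cannot all lie in
`ℤ·pΩ⁺_f/2` for `p > 1` — they generate `re Λ_f = ℤ·Ω⁺_f/2` and `Ω⁺_f ≠ 0`. -/
theorem not_forall_dvd_of_realPeriods (hre : realPeriods f = AddSubgroup.zmultiples (plusPeriod f / 2))
    (hΩ : plusPeriod f ≠ 0) {p : ℕ} (hp : 1 < p) {m : Gamma0 N → ℤ}
    (hm : ∀ γ, (cuspSymbol f γ).re = m γ * (plusPeriod f / 2)) : ¬ ∀ γ, (p : ℤ) ∣ m γ := by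
  intro hdvd
  have hle : realPeriods f ≤ AddSubgroup.zmultiples ((p : ℝ) * (plusPeriod f / 2)) := by
    rw [realPeriods, periodLattice, AddMonoidHom.map_closure, AddSubgroup.closure_le]
    rintro _ ⟨_, ⟨γ, rfl⟩, rfl⟩
    obtain ⟨k, hk⟩ := hdvd γ
    change (cuspSymbol f γ).re ∈ AddSubgroup.zmultiples ((p : ℝ) * (plusPeriod f / 2))
    rw [hm γ, hk, AddSubgroup.mem_zmultiples_iff]
    exact ⟨k, by push_cast; rw [zsmul_eq_mul]; ring⟩
  have hmem : plusPeriod f / 2 ∈ realPeriods f := by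
    rw [hre]; exact AddSubgroup.mem_zmultiples _
  obtain ⟨k, hk⟩ := AddSubgroup.mem_zmultiples_iff.mp (hle hmem)
  rw [zsmul_eq_mul] at hk
  have hkp : (k : ℝ) * p = 1 := by
    have h2 : plusPeriod f / 2 ≠ 0 := div_ne_zero hΩ two_ne_zero
    have h3 : ((k : ℝ) * p) * (plusPeriod f / 2) = 1 * (plusPeriod f / 2) := by
      rw [mul_assoc, hk, one_mul]
    exact mul_right_cancel₀ h2 h3
  have hkpZ : k * (p : ℤ) = 1 := by exact_mod_cast hkp
  have hp1 : (p : ℤ) ∣ 1 := ⟨k, by rw [mul_comm]; exact hkpZ.symm⟩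
  have : p = 1 := by exact_mod_cast Int.eq_one_of_dvd_one (by positivity) hp1
  omega

end Periods

section Elements

variable {N : ℕ}

/-- **Bezout**: for coprime `u, w` with `N ∣ w` there is `δ = (u ∗; w x) ∈ Γ₀(N)`, and then `x u ≡ 1 (mod N)`. -/
theorem exists_gamma0_of_isCoprime {u w : ℤ} (huw : IsCoprime u w) (hw : ((w : ℤ) : ZMod N) = 0) :
    ∃ (δ : Gamma0 N) (x : ℤ), ((δ : SL(2, ℤ)) 0 0 : ℤ) = u ∧ ((δ : SL(2, ℤ)) 1 0 : ℤ) = w ∧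
      ((δ : SL(2, ℤ)) 1 1 : ℤ) = x ∧ ((x * u : ℤ) : ZMod N) = 1 := by
  obtain ⟨x, y, hxy⟩ := huw
  have hdet : Matrix.det !![u, -y; w, x] = 1 := by
    rw [Matrix.det_fin_two_of]; linear_combination hxy
  have hmem : (⟨!![u, -y; w, x], hdet⟩ : SL(2, ℤ)) ∈ Gamma0 N := Gamma0_mem.mpr (by simpa using hw)
  refine ⟨⟨⟨!![u, -y; w, x], hdet⟩, hmem⟩, x, rfl, rfl, rfl, ?_⟩
  have h1 : ((x * u : ℤ) : ZMod N) = ((1 - y * w : ℤ) : ZMod N) := by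
    congr 1; linear_combination hxy
  rw [h1]; push_cast; rw [hw]; ring

/-- The `d`-entry of `δγ⁻¹`: `d(δγ⁻¹) = −c_δ b_γ + d_δ a_γ`. -/
theorem dEntry_mul_inv (δ γ : Gamma0 N) :
    dEntry (δ * γ⁻¹) =
      ((δ : SL(2, ℤ)) 1 0 : ℤ) * (-((γ : SL(2, ℤ)) 0 1 : ℤ)) +
        ((δ : SL(2, ℤ)) 1 1 : ℤ) * ((γ : SL(2, ℤ)) 0 0 : ℤ) := by
  simp [dEntry, coe_mul, coe_inv, Matrix.adjugate_fin_two, Matrix.mul_apply, Fin.sum_univ_two]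

/-- If `δ = (u ∗; w x)` with `N ∣ w`, `x u ≡ 1`, and `v·a_γ ≡ u (mod N)` for `v = pᵏ`... packaged as: from
`((x * a_γ : ℤ) : ZMod N) = p ^ k` conclude `δγ⁻¹ ∈ Γ_H(N)`. -/
theorem inGammaH_mul_inv_of_eq_pow {p : ℕ} {δ γ : Gamma0 N} {x : ℤ}
    (hw : (((δ : SL(2, ℤ)) 1 0 : ℤ) : ZMod N) = 0) (hx : ((δ : SL(2, ℤ)) 1 1 : ℤ) = x) {k : ℕ}
    (h : ((x * ((γ : SL(2, ℤ)) 0 0 : ℤ) : ℤ) : ZMod N) = (p : ZMod N) ^ k) :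
    InGammaH N p (δ * γ⁻¹) := by
  refine ⟨k, Or.inl ?_⟩
  rw [dEntry_mul_inv, ← hx] at *
  push_cast at h ⊢
  rw [hw, zero_mul, zero_add]
  exact h

variable [NeZero N] {p : ℕ} [Fact p.Prime]

/-- `p^{φ(N) - 1} · p = 1` in `ℤ/N` for `p ∤ N` (Euler), so `p⁻¹` is a power of `p`. -/
theorem pow_totient_sub_one_mul_self (hpN : ¬ p ∣ N) :
    (p : ZMod N) ^ (Nat.totient N - 1) * p = 1 := by
  have hp : p.Prime := Fact.out
  have hcop : p.Coprime N := (Nat.Prime.coprime_iff_not_dvd hp).mpr hpN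
  have htot : 0 < Nat.totient N := Nat.totient_pos.mpr (NeZero.pos N)
  have h1 : (p : ZMod N) ^ Nat.totient N = 1 := by
    have := ZMod.pow_totient (ZMod.unitOfCoprime p hcop)
    rw [Units.ext_iff, Units.val_pow_eq_pow_val, ZMod.coe_unitOfCoprime] at this
    simpa using this
  rw [← pow_succ, Nat.sub_add_cancel htot, h1]

omit [NeZero N] in
/-- **The Hecke terms `(a + jc)/(pc)` are cusps `δ∞` with `δ ∈ Γ_H(N)·γ`**: for `γ = (a b; c d) ∈ Γ₀(N)`
with `c ≠ 0` and `p ∤ N`, and any integer `j`, there is `δ ∈ Γ₀(N)` with `c_δ ≠ 0`,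
`δ∞ = (a + jc)/(pc)` and `d(δγ⁻¹) ≡ 1` or `p` (mod `N`) according as `p ∤ a + jc` or `p ∣ a + jc`. -/
theorem exists_heckeTerm_mem (γ : Gamma0 N) (hc : ((γ : SL(2, ℤ)) 1 0 : ℤ) ≠ 0)
    (j : ℤ) :
    ∃ δ : Gamma0 N, ((δ : SL(2, ℤ)) 1 0 : ℤ) ≠ 0 ∧
      (((δ : SL(2, ℤ)) 0 0 : ℤ) : ℚ) / (((δ : SL(2, ℤ)) 1 0 : ℤ) : ℚ) =
        ((((γ : SL(2, ℤ)) 0 0 : ℤ) : ℚ) + j * ((γ : SL(2, ℤ)) 1 0 : ℤ)) /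
          ((p : ℚ) * ((γ : SL(2, ℤ)) 1 0 : ℤ)) ∧
      InGammaH N p (δ * γ⁻¹) := by
  have hp : p.Prime := Fact.out
  set a : ℤ := (γ : SL(2, ℤ)) 0 0 with ha
  set b : ℤ := (γ : SL(2, ℤ)) 0 1 with hb
  set c : ℤ := (γ : SL(2, ℤ)) 1 0 with hc'
  set d : ℤ := (γ : SL(2, ℤ)) 1 1 with hd
  have hdet : a * d - b * c = 1 := by
    have := Matrix.SpecialLinearGroup.det_coe (γ : SL(2, ℤ))
    rw [Matrix.det_fin_two] at this
    rw [ha, hb, hc', hd]; linear_combination this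
  have hac : IsCoprime a c := ⟨d, -b, by linear_combination hdet⟩
  have hcN : ((c : ℤ) : ZMod N) = 0 := by
    have := Gamma0_mem.mp γ.2
    rwa [hc']
  have hajc : IsCoprime (a + j * c) c := by
    simpa [add_comm, mul_comm] using hac.add_mul_left_left j
  have hpZ : Prime (p : ℤ) := Nat.prime_iff_prime_int.mp hp
  have hcQ : (c : ℚ) ≠ 0 := by exact_mod_cast hc
  have hpQ : (p : ℚ) ≠ 0 := by exact_mod_cast hp.ne_zero
  by_cases hdiv : (p : ℤ) ∣ a + j * c
  · -- `a + jc = p u`, `δ = (u ∗; c x)`, `x a ≡ x p u ≡ p`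
    obtain ⟨u, hu⟩ := hdiv
    have huc : IsCoprime u c := by
      rw [hu] at hajc
      exact hajc.of_mul_left_right
    obtain ⟨δ, x, h00, h10, h11, hxu⟩ := exists_gamma0_of_isCoprime (N := N) huc hcN
    refine ⟨δ, by rw [h10]; exact hc, ?_, ?_⟩
    · rw [h00, h10]
      have huQ : (a : ℚ) + j * c = p * u := by exact_mod_cast hu
      rw [huQ]
      field_simp
    · refine inGammaH_mul_inv_of_eq_pow (k := 1) (by rw [h10]; exact hcN) h11 ?_
      rw [← ha, pow_one]
      have h2 : x * a = p * (x * u) - x * j * c := by linear_combination x * hu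
      rw [h2]
      push_cast at hxu ⊢
      rw [hcN]
      linear_combination (p : ZMod N) * hxu
  · -- `δ = (a + jc, ∗; pc, x)`, `x a ≡ x (a + jc) ≡ 1`
    have hcop : IsCoprime (a + j * c) (p * c) :=
      IsCoprime.mul_right ((Prime.coprime_iff_not_dvd hpZ).mpr hdiv).symm hajc
    have hpcN : ((p * c : ℤ) : ZMod N) = 0 := by push_cast; rw [hcN, mul_zero]
    obtain ⟨δ, x, h00, h10, h11, hxu⟩ := exists_gamma0_of_isCoprime (N := N) hcop hpcN
    refine ⟨δ, ?_, ?_, ?_⟩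
    · rw [h10]; exact mul_ne_zero (by exact_mod_cast hp.ne_zero) hc
    · rw [h00, h10]; push_cast; ring
    · refine inGammaH_mul_inv_of_eq_pow (k := 0) (by rw [h10]; exact hpcN) h11 ?_
      rw [← ha, pow_zero]
      have h2 : x * a = x * (a + j * c) - x * j * c := by ring
      rw [h2]
      push_cast at hxu ⊢
      rw [hcN] at hxu ⊢
      linear_combination hxu

/-- **The Hecke term `pa/c` is a cusp `δ∞` with `δ ∈ Γ_H(N)·γ`**: `d(δγ⁻¹) ≡ p^{φ(N)−1}` (`= p⁻¹`) or
`1` (mod `N`) according as `p ∤ c` or `p ∣ c`. -/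
theorem exists_heckeTerm_mem' (hpN : ¬ p ∣ N) (γ : Gamma0 N) (hc : ((γ : SL(2, ℤ)) 1 0 : ℤ) ≠ 0) :
    ∃ δ : Gamma0 N, ((δ : SL(2, ℤ)) 1 0 : ℤ) ≠ 0 ∧
      (((δ : SL(2, ℤ)) 0 0 : ℤ) : ℚ) / (((δ : SL(2, ℤ)) 1 0 : ℤ) : ℚ) =
        (p : ℚ) * ((((γ : SL(2, ℤ)) 0 0 : ℤ) : ℚ) / ((γ : SL(2, ℤ)) 1 0 : ℤ)) ∧
      InGammaH N p (δ * γ⁻¹) := by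
  have hp : p.Prime := Fact.out
  set a : ℤ := (γ : SL(2, ℤ)) 0 0 with ha
  set b : ℤ := (γ : SL(2, ℤ)) 0 1 with hb
  set c : ℤ := (γ : SL(2, ℤ)) 1 0 with hc'
  set d : ℤ := (γ : SL(2, ℤ)) 1 1 with hd
  have hdet : a * d - b * c = 1 := by
    have := Matrix.SpecialLinearGroup.det_coe (γ : SL(2, ℤ))
    rw [Matrix.det_fin_two] at this
    rw [ha, hb, hc', hd]; linear_combination this
  have hac : IsCoprime a c := ⟨d, -b, by linear_combination hdet⟩
  have hcN : ((c : ℤ) : ZMod N) = 0 := by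
    have := Gamma0_mem.mp γ.2
    rwa [hc']
  have hpZ : Prime (p : ℤ) := Nat.prime_iff_prime_int.mp hp
  have hcQ : (c : ℚ) ≠ 0 := by exact_mod_cast hc
  have hpQ : (p : ℚ) ≠ 0 := by exact_mod_cast hp.ne_zero
  have hNp : IsCoprime (N : ℤ) (p : ℤ) :=
    Nat.isCoprime_iff_coprime.mpr ((Nat.Prime.coprime_iff_not_dvd hp).mpr hpN).symm
  by_cases hdiv : (p : ℤ) ∣ c
  · -- `c = p c'`, `δ = (a ∗; c' x)`, `x a ≡ 1`
    obtain ⟨c₁, hc₁⟩ := hdiv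
    have hac₁ : IsCoprime a c₁ := by
      rw [hc₁] at hac
      exact hac.of_mul_right_right
    have hc₁N : ((c₁ : ℤ) : ZMod N) = 0 := by
      rw [ZMod.intCast_zmod_eq_zero_iff_dvd] at hcN ⊢
      rw [hc₁] at hcN
      exact hNp.dvd_of_dvd_mul_left hcN
    have hc₁0 : c₁ ≠ 0 := by rintro rfl; exact hc (by simpa using hc₁)
    obtain ⟨δ, x, h00, h10, h11, hxu⟩ := exists_gamma0_of_isCoprime (N := N) hac₁ hc₁N
    refine ⟨δ, by rw [h10]; exact hc₁0, ?_, ?_⟩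
    · rw [h00, h10]
      have : (c : ℚ) = p * c₁ := by exact_mod_cast hc₁
      rw [this]
      have hc₁Q : (c₁ : ℚ) ≠ 0 := by exact_mod_cast hc₁0
      field_simp
    · refine inGammaH_mul_inv_of_eq_pow (k := 0) (by rw [h10]; exact hc₁N) h11 ?_
      rw [← ha, pow_zero]
      exact hxu
  · -- `δ = (pa ∗; c x)`, `x p a ≡ 1`, so `x a ≡ p^{φ(N) - 1}`
    have hcop : IsCoprime (p * a) c :=
      IsCoprime.mul_left ((Prime.coprime_iff_not_dvd hpZ).mpr hdiv) hac
    obtain ⟨δ, x, h00, h10, h11, hxu⟩ := exists_gamma0_of_isCoprime (N := N) hcop hcN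
    refine ⟨δ, by rw [h10]; exact hc, ?_, ?_⟩
    · rw [h00, h10]; push_cast; ring
    · refine inGammaH_mul_inv_of_eq_pow (k := Nat.totient N - 1) (by rw [h10]; exact hcN) h11 ?_
      rw [← ha]
      have key := pow_totient_sub_one_mul_self (N := N) (p := p) hpN
      push_cast at hxu ⊢
      -- `x a = x a · (p^{φ-1} p) = (x p a) p^{φ-1} = p^{φ-1}`
      calc (x : ZMod N) * a = (x * a) * ((p : ZMod N) ^ (Nat.totient N - 1) * p) := by rw [key, mul_one]
        _ = (x * (p * a)) * (p : ZMod N) ^ (Nat.totient N - 1) := by ring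
        _ = (p : ZMod N) ^ (Nat.totient N - 1) := by rw [hxu, one_mul]

end Elements

end Summit.BirchSwinnertonDyer.BirchSwinnertonDyer.Theorems.PrintX8VerticalStevens

end
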